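import Summits.QuantumFields.YangMills.Theorems.BalabanUVNodesN11NoExpansionRoughFibre
import Literature.MathematicalPhysics.QuantumFieldTheory.Balaban1983to89.Node00.StepWeightsAtNoExpansion

/-!
# DAG node N11 — THE KERNEL HALF OF Q-W REDUCED TO def-R's (2.12) BRANCH: at EVERY Stage-13 witness, `TLaw₁₃ θ p 0` forces (i) the rough coarse fields
# at which EVERY χ₁-cube is (3.2)-LARGE to carry NO averaged mass (`avgDensity = 0` a.e. there, `dU{Ū ∈ S} = 0`), and (ii) the rough coarse fields at
# which EVERY χ₁-cube is (3.2)-SMALL to carry NO CUBE-ROUGH FINE FIELD on their averaging fibres (`avgDensity·avgKernel(cube-rough) = 0` a.e.,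
# `dU{U cube-rough, Ū ∈ S} = 0`) — the residual `ζ`, the residual `Zt` and the (3.3) labels ELIMINATED

Cell `pub-ymgap`, YM-PLAN Track A (HUMAN RULING D-0062), seat `pub-ymgap-dag-n11-d` (g5; R134 fan-out seat N11 [B14], strategy s2), item K1‴ `StabilityBAtRecordR13e`
= stmt-QuantumFields-19910.  [III] = [Balaban1988Convergent], [B7] = [Balaban1985Averaging].  Sequel of this seat's `…NoExpansionRoughFibre` (p496847: `TLaw₁₃ θ p 0`
⇒ def-T's all-large-field pre-𝐑 slot `slotT_1(s′₀)(V₁) = T[w(s′₀)(·,V₁)ρ₀](V₁)` vanishes for a.e. rough `V₁`, at every witness) over this seat's Literature-side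
`Node00.StepWeightsAtNoExpansion` (def-T's step weight at `s′₀` in closed form; the two extreme labels of the first step).

WHY THIS FILE (pub-ymgap INBOX: dag-lead ME #15 «the KERNEL half is yours»; lit-balaban DESK-ANSWER ME #15: print half of Q-W = NO, a typed-statement defect
at the 12a∕def-T junction).  With the step weight computed, `slotT_1(s′₀)` is EXPLICIT on two classes of coarse fields `V₁`, whatever `θ.ζ`, `θ.Zt`, the term
values and the run: (i) ALL-(3.2)-LARGE `V₁` (def-R's localized background (2.16) non-flat on every `□′^∼`): `w(s′₀)(·,V₁) ≡ 1`, so `slotT_1(s′₀)(V₁) =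
T[ρ₀](V₁) = avgDensity(V₁)·∫ρ₀ d(avgKernel V₁)` (§1), the second factor positive; a.e. vanishing of the slot on a class of coarse fields ⇒ **`avgDensity = 0`
a.e. on its all-large members** ⇒ `dU{U : Ū ∈ S} = 0` for every measurable `S` of them (§2).  (ii) ALL-(3.2)-SMALL `V₁` (background `ε₁η₁²`-flat on every
`□′^∼` — in particular def-R's UNIT default everywhere): for every CUBE-ROUGH old field `U` (a plaquette with `dist1 ≥ ε₁η₁² + 4·(2δ₀)` inside every `□′^∼`)
`w(s′₀)(U,V₁) = 1`, so `slotT_1(s′₀)(V₁) ≥ avgDensity(V₁)·∫_R ρ₀ d(avgKernel V₁)` for every measurable set `R` of cube-rough fields; a.e. vanishing ⇒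
**`avgDensity = 0 ∨ avgKernel(·)(R) = 0` a.e. on the all-small members** ⇒ `dU{U ∈ R, Ū ∈ S} = 0` (§3; disintegration `dU = (dV₁·avgDensity) ⊗ avgKernel` along
the graph).  With `…RoughFibre` both hold under `TLaw₁₃ θ p 0` on the ROUGH coarse fields at EVERY witness (any `Zt`: 12a's measurability ∕ bound displayed;
`Zt = ZtOfRecord`: discharged), and (§4) AT K0a's WITNESS OF RECORD `theta13LiveOfRecord` with hypotheses `0 ≤ g₀`, `0 < K`, the [B7] guards on `α₀` with
`ε₀(g₀) ≤ α₀η₁²`, `TLaw₁₃` ONLY (`M = M₂ = 1`, ζ of record).  So Q-W in the tree is now ONE question about def-R's solution map `UminOfRecord` at rough data —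
which cubes of a rough `Ū` carry a non-flat (2.12) minimiser (selector∕choice branch) and which the unit default: (i) forbids ANY fine field, (ii) every
cube-rough fine field, from averaging into the corresponding rough coarse fields (up to null sets).  Neither branch nor the Haar-positivity of those preimages is
decided here; both consequences are kernel facts at every witness.

HONEST FRAMING.  Count-neutral kernel bookkeeping; necessary conditions of the typed (S1ᵀ)₁₃ at its first step; nothing of Bałaban's asserted or refuted;
N11 ∕ K1‴ NOT discharged ∕ refuted; counts unmoved (typed 28∕28 · discharged 5∕28).  One finite four-torus at fixed `ε = L^{−K}`; NOT ℝ⁴ ∕ OS ∕ mass gap ∕ Clay.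
Sources: [III] Theorem p.245, (2.10)–(2.12) p.256, (2.16)–(2.17) p.257, (3.1)–(3.5) pp.264–265, (3.25) p.270; [B7] (10) p.19, Prop. 2 (53) p.26.
-/

noncomputable section

open MeasureTheory ProbabilityTheory
open scoped BigOperators Matrix.Norms.L2Operator ENNReal NNReal

namespace Summit.QuantumFields.YangMills.Theorems.BalabanUVNodesN11AllLargeFieldLabel

open Literature.MathematicalPhysics.QuantumFieldTheory.Balaban1983to89 T4Continuum Node00 Node00.Tk DagBinding
open Literature.MathematicalPhysics.QuantumFieldTheory.Balaban1983to89.T4AveragingDisintegration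
  (transportK kernelTransport avgKernel avgDensity jointLaw withDensity_margDensity disintegration_fieldMeasure measurable_graphMap
    measurable_margDensity)
open Literature.MathematicalPhysics.QuantumFieldTheory.Balaban1983to89.ExpMeanLog (deltaSU)
open GaugeField (plaqHol)
open Summit.QuantumFields.YangMills.Theorems.BalabanUVNodesN11NoExpansionRoughFibre
  (slotsT_one_ae_zero_on_rough_of_tLaw₁₃ slotsT_one_ae_zero_on_rough_of_tLaw₁₃_of_Zt_eq_ZtOfRecord slotsT_one_ae_zero_on_rough_theta13LiveOfRecord)
open Summit.QuantumFields.YangMills.Theorems.BalabanUVNodesN11NoExpansionTermFree (one_le_M_theta13LiveOfFamily)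

variable {F : T4Family} {N : ℕ} [NeZero N]

/-! ## §1. Pointwise: the all-large-field slot on an all-(3.2)-large coarse field IS the transport of `ρ₀`; the transport of `ρ₀` vanishes iff `avgDensity` does -/

section Pointwise

variable (θ : Stage13Params F N) (p : B12.RunParams)

/-- **ON AN ALL-(3.2)-LARGE COARSE FIELD THE ALL-LARGE-FIELD PRE-𝐑 SLOT IS THE TRANSPORT OF `ρ₀`** (pointwise in `V₁`; ζ-unity, `0 <` the two cube sides):
`w(s′₀)(·,V₁) ≡ 1` there (`StepWeightsAtNoExpansion.wOfRecord_zero_eq_one_of_forall_chiFactor_eq_zero`), `g_0 = g₀` of the run.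
[cite: Balaban1988Convergent, (3.1)–(3.5) pp.264–265, (3.25) p.270] -/
theorem slotsT_one_eq_transport_rhoZero_of_forall_chiFactor_eq_zero (hζ : IsZetaUnity F N θ.ν θ.τ9.M θ.ζ)
    (hD : 0 < sideD F θ.ν θ.τ9.M p (gOfRecord₁₃ F N θ p) 0) (hχ : 0 < sideχ F θ.ν p (gOfRecord₁₃ F N θ p) 0)
    (s : SeqOfRecord F θ.ν θ.τ9.M (gOfRecord₁₃ F N θ p) p.K 1) (hΩ : s.Ω 1 = ∅) (V1 : GaugeField (F.P p.K) 1 (SU N))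
    (h : ∀ c : Iχ F θ.ν p (gOfRecord₁₃ F N θ p) 0, chiFactor F N θ.ν p (gOfRecord₁₃ F N θ p) 0 c V1 = 0) :
    slotsTOfRecord F N θ.ν θ.τ9 (EOfRecord₁₃ F N θ) (wOfRecord₉ F N θ.toStage9Params) θ.ppSel p (gOfRecord₁₃ F N θ p) 1 s V1 =
      transportOfRecord F N p.K 0 (rhoZeroOfRecord F N p.K p.g0 (EOfRecord₁₃ F N θ p)) V1 := by
  rw [slotsTOfRecord_one_apply]
  have h0 : gOfRecord₁₃ F N θ p 0 = p.g0 := FlowStepRuns.genSeq_zero _ _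
  have hfg : (fun U => wOfRecord₉ F N θ.toStage9Params p (gOfRecord₁₃ F N θ p) 0 s U V1 *
        rhoZeroOfRecord F N p.K (gOfRecord₁₃ F N θ p 0) (EOfRecord₁₃ F N θ p) U) =
      rhoZeroOfRecord F N p.K p.g0 (EOfRecord₁₃ F N θ p) := by
    funext U
    have hw : wOfRecord₉ F N θ.toStage9Params p (gOfRecord₁₃ F N θ p) 0 s U V1 = 1 :=
      wOfRecord_zero_eq_one_of_forall_chiFactor_eq_zero F N θ.ν θ.τ9.M θ.A₁ p (gOfRecord₁₃ F N θ p) hζ hD hχ s hΩ U V1 h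
    rw [hw, one_mul, h0]
  rw [hfg]

/-- The averaging kernel integrates `ρ₀ > 0` to a positive number at EVERY coarse field (a probability kernel). [cite: Balaban1985Averaging, (10) p.19 (bookkeeping)] -/
theorem integral_rhoZero_avgKernel_pos (K : ℕ) (g₀ E : ℝ) (V1 : GaugeField (F.P K) 1 (SU N)) :
    0 < ∫ U, rhoZeroOfRecord F N K g₀ E U ∂(avgKernel (avOfRecord F N K 0).avg V1) := by
  have hI : Integrable (rhoZeroOfRecord F N K g₀ E) (avgKernel (avOfRecord F N K 0).avg V1) :=
    (integrable_const (Real.exp (-E))).mono' (measurable_rhoZeroOfRecord F N K g₀ E).aestronglyMeasurable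
      (Filter.Eventually.of_forall fun U => by
        rw [Real.norm_eq_abs, abs_of_pos (rhoZeroOfRecord_pos F N K g₀ E U)]
        exact rhoZeroOfRecord_le F N K g₀ E U)
  rw [integral_pos_iff_support_of_nonneg (fun U => (rhoZeroOfRecord_pos F N K g₀ E U).le) hI]
  have hsupp : Function.support (rhoZeroOfRecord F N K g₀ E) = Set.univ :=
    Set.eq_univ_of_forall fun U => (rhoZeroOfRecord_pos F N K g₀ E U).ne'
  rw [hsupp, measure_univ]
  exact one_pos

/-- **THE TRANSPORT OF `ρ₀` VANISHES EXACTLY WHERE THE MARGINAL DENSITY OF THE AVERAGING DOES** (`T[ρ₀](V₁) = avgDensity(V₁)·∫ρ₀ d(avgKernel V₁)`, the second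
factor positive). [cite: Balaban1985Averaging, (10) p.19; Balaban1988Convergent, (3.1) p.264 (bookkeeping)] -/
theorem transportOfRecord_rhoZero_eq_zero_iff (K : ℕ) (g₀ E : ℝ) (V1 : GaugeField (F.P K) 1 (SU N)) :
    transportOfRecord F N K 0 (rhoZeroOfRecord F N K g₀ E) V1 = 0 ↔ (avgDensity (avOfRecord F N K 0).avg V1 : ℝ) = 0 := by
  show (avgDensity (avOfRecord F N K 0).avg V1 : ℝ) * ∫ U, rhoZeroOfRecord F N K g₀ E U ∂(avgKernel (avOfRecord F N K 0).avg V1) = 0 ↔ _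
  rw [mul_eq_zero]
  exact or_iff_left (integral_rhoZero_avgKernel_pos K g₀ E V1).ne'

end Pointwise

/-! ## §2. The rough ALL-(3.2)-LARGE coarse fields: a.e. vanishing of the slot ⇒ no averaged mass -/

section AllLarge

variable (θ : Stage13Params F N) (p : B12.RunParams)

/-- **IF THE ALL-LARGE-FIELD SLOT VANISHES a.e. ON A CLASS `Ro` OF COARSE FIELDS, THEN `avgDensity = 0` a.e. ON THE ALL-(3.2)-LARGE MEMBERS OF `Ro`**
(ζ-unity, `0 <` the two cube sides). [cite: Balaban1988Convergent, (3.1)–(3.5) pp.264–265, (3.25) p.270; Balaban1985Averaging, (10) p.19] -/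
theorem avgDensity_ae_zero_on_allLarge_of_slotsT_ae_zero (hζ : IsZetaUnity F N θ.ν θ.τ9.M θ.ζ)
    (hD : 0 < sideD F θ.ν θ.τ9.M p (gOfRecord₁₃ F N θ p) 0) (hχ : 0 < sideχ F θ.ν p (gOfRecord₁₃ F N θ p) 0)
    (s : SeqOfRecord F θ.ν θ.τ9.M (gOfRecord₁₃ F N θ p) p.K 1) (hΩ : s.Ω 1 = ∅) {Ro : GaugeField (F.P p.K) 1 (SU N) → Prop}
    (hvan : ∀ᵐ V1 ∂fieldMeasure (F.P p.K) 1 (SU N), Ro V1 →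
      slotsTOfRecord F N θ.ν θ.τ9 (EOfRecord₁₃ F N θ) (wOfRecord₉ F N θ.toStage9Params) θ.ppSel p (gOfRecord₁₃ F N θ p) 1 s V1 = 0) :
    ∀ᵐ V1 ∂fieldMeasure (F.P p.K) 1 (SU N), Ro V1 →
      (∀ c : Iχ F θ.ν p (gOfRecord₁₃ F N θ p) 0, chiFactor F N θ.ν p (gOfRecord₁₃ F N θ p) 0 c V1 = 0) →
        (avgDensity (avOfRecord F N p.K 0).avg V1 : ℝ) = 0 := by
  filter_upwards [hvan] with V1 hV1 hrough hlarge
  have h0 := hV1 hrough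
  rw [slotsT_one_eq_transport_rhoZero_of_forall_chiFactor_eq_zero θ p hζ hD hχ s hΩ V1 hlarge] at h0
  exact (transportOfRecord_rhoZero_eq_zero_iff p.K _ _ V1).1 h0

/-- **MEASURE FORM**: if `avgDensity = 0` a.e. on the all-(3.2)-large members of `Ro`, then EVERY measurable set `S` of such fields has `dU{U : Ū ∈ S} = 0`
(`dU.map avg = dV₁.withDensity avgDensity` by `HaarAC` of the averaging of record, `0 < K`). [cite: Balaban1985Averaging, (10) p.19 (bookkeeping); Balaban1988Convergent, (3.1) p.264] -/
theorem fieldMeasure_preimage_eq_zero_of_avgDensity_ae_zero (hK : 0 < p.K) {Ro A : GaugeField (F.P p.K) 1 (SU N) → Prop}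
    (hae : ∀ᵐ V1 ∂fieldMeasure (F.P p.K) 1 (SU N), Ro V1 → A V1 → (avgDensity (avOfRecord F N p.K 0).avg V1 : ℝ) = 0)
    {S : Set (GaugeField (F.P p.K) 1 (SU N))} (hS : MeasurableSet S) (hSR : ∀ V1 ∈ S, Ro V1) (hSA : ∀ V1 ∈ S, A V1) :
    fieldMeasure (F.P p.K) 0 (SU N) ((avOfRecord F N p.K 0).avg ⁻¹' S) = 0 := by
  have havg : Measurable (avOfRecord F N p.K 0).avg := avOfRecord_measurable F N p.K 0
  have hac := avOfRecord_haarAC F N p.K 0 hK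
  rw [← Measure.map_apply havg hS, ← withDensity_margDensity _ _ havg hac, withDensity_apply _ hS]
  have hzero : ∀ᵐ V1 ∂fieldMeasure (F.P p.K) 1 (SU N), V1 ∈ S → (avgDensity (avOfRecord F N p.K 0).avg V1 : ℝ≥0∞) = 0 := by
    filter_upwards [hae] with V1 hV1 hmem
    exact ENNReal.coe_eq_zero.2 (NNReal.coe_eq_zero.1 (hV1 (hSR V1 hmem) (hSA V1 hmem)))
  rw [lintegral_congr_ae ((ae_restrict_iff' hS).2 (hzero.mono fun V1 h => h)), lintegral_zero]

/-- **AT EVERY WITNESS** (any `θ.ζ` with unity, any `θ.Zt` with 12a's measurability ∕ bound displayed as in `…RoughFibre`; junction, `M ≥ 1`, `0 < K`, the [B7]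
guards): `TLaw₁₃ θ p 0` ⇒ for `dV₁`-a.e. `V₁` that is not `2α₀`-plaquette-small and at which EVERY χ₁-cube is (3.2)-large, `avgDensity(V₁) = 0` — hence
`dU{U : Ū ∈ S} = 0` for every measurable `S` of such coarse fields (`fieldMeasure_preimage_eq_zero_of_avgDensity_ae_zero`).
[cite: Balaban1988Convergent, Theorem p.245, (3.1)–(3.5) pp.264–265, (3.25) p.270, (2.10) p.256; Balaban1985Averaging, Prop. 2 (53) p.26] -/
theorem avgDensity_ae_zero_on_rough_allLarge_of_tLaw₁₃ (hζ : IsZetaUnity F N θ.ν θ.τ9.M θ.ζ)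
    (hD : 0 < sideD F θ.ν θ.τ9.M p (gOfRecord₁₃ F N θ p) 0) (hχ : 0 < sideχ F θ.ν p (gOfRecord₁₃ F N θ p) 0)
    (hc : θ.s2.cR * epsOfRecord θ.ν (gOfRecord₁₃ F N θ p) 0 ≤ θ.ν.εreg * (F.P p.K).eta 0 ^ 2)
    (hM : 1 ≤ θ.τ9.M) (hK : 0 < p.K) (s : SeqOfRecord F θ.ν θ.τ9.M (gOfRecord₁₃ F N θ p) p.K 1) (hΩ : s.Ω 1 = ∅)
    (hT : TLaw₁₃ F N θ p 0) {α₀ : ℝ} (hα : 0 < α₀)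
    (hα3 : (143 * (((((F.P p.K).d + 4 : ℕ) : ℝ)) ^ 2 / 4) ^ 2) * α₀ ≤ 1 / 3)
    (hα2 : 2 * α₀ ≤ 2 * deltaSU (Fin N) / ((((F.P p.K).d + 4) * (F.P p.K).L : ℕ) : ℝ) ^ 2)
    (hαε : θ.s2.cR * epsOfRecord θ.ν (gOfRecord₁₃ F N θ p) 0 ≤ α₀ * (F.P p.K).eta 1 ^ 2)
    {C : ℝ}
    (hm : Measurable (Function.uncurry fun (V1 : GaugeField (F.P p.K) 1 (SU N)) (Uf : GaugeField (F.P p.K) 0 (SU N)) =>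
      (θ.Zt p.K).ζ0 0 Set.univ (pairCfg V1 Uf) *
          chiRegW F N (FluctV N) θ.ν θ.s2.cR p (gOfRecord₁₃ F N θ p) 0 Set.univ (pairCfg (V := FluctV N) V1 Uf) *
        (Real.exp (-(1 / 2 : ℝ) * (θ.Zt p.K).quad 0 ∅ (pairCfg V1 Uf)) * rhoZeroOfRecord F N p.K p.g0 (EOfRecord₁₃ F N θ p) Uf)))
    (hC : ∀ (V1 : GaugeField (F.P p.K) 1 (SU N)) (Uf : GaugeField (F.P p.K) 0 (SU N)),
      |(θ.Zt p.K).ζ0 0 Set.univ (pairCfg V1 Uf) *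
          chiRegW F N (FluctV N) θ.ν θ.s2.cR p (gOfRecord₁₃ F N θ p) 0 Set.univ (pairCfg (V := FluctV N) V1 Uf) *
        (Real.exp (-(1 / 2 : ℝ) * (θ.Zt p.K).quad 0 ∅ (pairCfg V1 Uf)) * rhoZeroOfRecord F N p.K p.g0 (EOfRecord₁₃ F N θ p) Uf)| ≤ C) :
    ∀ᵐ V1 ∂fieldMeasure (F.P p.K) 1 (SU N), ¬ PlaqSmall (2 * α₀ * (((F.P p.K).L : ℝ) ^ 1 * (F.P p.K).eta 1) ^ 2) V1 →
      (∀ c : Iχ F θ.ν p (gOfRecord₁₃ F N θ p) 0, chiFactor F N θ.ν p (gOfRecord₁₃ F N θ p) 0 c V1 = 0) →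
        (avgDensity (avOfRecord F N p.K 0).avg V1 : ℝ) = 0 :=
  avgDensity_ae_zero_on_allLarge_of_slotsT_ae_zero θ p hζ hD hχ s hΩ
    (slotsT_one_ae_zero_on_rough_of_tLaw₁₃ θ p hc hM hK s hΩ hT hα hα3 hα2 hαε hm hC)

/-- **THE SAME AT A `θ` WITH `θ.Zt = ZtOfRecord`** (12a's displayed measurability ∕ bound discharged by `…RoughFibre`).
[cite: Balaban1988Convergent, Theorem p.245, (3.25) p.270, (2.10) p.256; Balaban1985Averaging, Prop. 2 (53) p.26] -/
theorem avgDensity_ae_zero_on_rough_allLarge_of_tLaw₁₃_of_Zt_eq_ZtOfRecord (hZt : θ.Zt = ZtOfRecord F N) (hζ : IsZetaUnity F N θ.ν θ.τ9.M θ.ζ)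
    (hD : 0 < sideD F θ.ν θ.τ9.M p (gOfRecord₁₃ F N θ p) 0) (hχ : 0 < sideχ F θ.ν p (gOfRecord₁₃ F N θ p) 0)
    (hc : θ.s2.cR * epsOfRecord θ.ν (gOfRecord₁₃ F N θ p) 0 ≤ θ.ν.εreg * (F.P p.K).eta 0 ^ 2)
    (hM : 1 ≤ θ.τ9.M) (hK : 0 < p.K) (s : SeqOfRecord F θ.ν θ.τ9.M (gOfRecord₁₃ F N θ p) p.K 1) (hΩ : s.Ω 1 = ∅)
    (hT : TLaw₁₃ F N θ p 0) {α₀ : ℝ} (hα : 0 < α₀)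
    (hα3 : (143 * (((((F.P p.K).d + 4 : ℕ) : ℝ)) ^ 2 / 4) ^ 2) * α₀ ≤ 1 / 3)
    (hα2 : 2 * α₀ ≤ 2 * deltaSU (Fin N) / ((((F.P p.K).d + 4) * (F.P p.K).L : ℕ) : ℝ) ^ 2)
    (hαε : θ.s2.cR * epsOfRecord θ.ν (gOfRecord₁₃ F N θ p) 0 ≤ α₀ * (F.P p.K).eta 1 ^ 2) :
    ∀ᵐ V1 ∂fieldMeasure (F.P p.K) 1 (SU N), ¬ PlaqSmall (2 * α₀ * (((F.P p.K).L : ℝ) ^ 1 * (F.P p.K).eta 1) ^ 2) V1 →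
      (∀ c : Iχ F θ.ν p (gOfRecord₁₃ F N θ p) 0, chiFactor F N θ.ν p (gOfRecord₁₃ F N θ p) 0 c V1 = 0) →
        (avgDensity (avOfRecord F N p.K 0).avg V1 : ℝ) = 0 :=
  avgDensity_ae_zero_on_allLarge_of_slotsT_ae_zero θ p hζ hD hχ s hΩ
    (slotsT_one_ae_zero_on_rough_of_tLaw₁₃_of_Zt_eq_ZtOfRecord θ p hZt hc hM hK s hΩ hT hα hα3 hα2 hαε)

end AllLarge

/-! ## §3. The rough ALL-(3.2)-SMALL coarse fields: a.e. vanishing of the slot ⇒ no cube-rough fine field on the averaging fibres -/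

section AllSmall

variable (θ : Stage13Params F N) (p : B12.RunParams)

/-- **ON AN ALL-(3.2)-SMALL COARSE FIELD THE ALL-LARGE-FIELD SLOT DOMINATES THE FIBRE MASS OF ANY SET OF CUBE-ROUGH OLD FIELDS** (pointwise in `V₁`): for a
measurable set `R` of old fields each having, inside every `□′^∼`, a plaquette with `dist1 ≥ ε₁η₁² + 4·(2δ₀)`,
`avgDensity(V₁)·∫_R ρ₀ d(avgKernel V₁) ≤ slotT_1(s′₀)(V₁)` — `w(s′₀)(U,V₁) = 1` on `R` (`StepWeightsAtNoExpansion.wOfRecord_zero_eq_one_of_forall_chiFactor_eq_one_of_cubeRough`)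
and `0 ≤ w(s′₀)(·,V₁) ≤ 1` measurable. [cite: Balaban1988Convergent, (3.1)–(3.5) pp.264–265, (3.25) p.270] -/
theorem fibre_mass_le_slotsT_one_of_forall_chiFactor_eq_one (hζ : IsZetaUnity F N θ.ν θ.τ9.M θ.ζ)
    (hD : 0 < sideD F θ.ν θ.τ9.M p (gOfRecord₁₃ F N θ p) 0) (hχ : 0 < sideχ F θ.ν p (gOfRecord₁₃ F N θ p) 0)
    (s : SeqOfRecord F θ.ν θ.τ9.M (gOfRecord₁₃ F N θ p) p.K 1) (hΩ : s.Ω 1 = ∅)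
    {R : Set (GaugeField (F.P p.K) 0 (SU N))} (hRm : MeasurableSet R)
    (hR : ∀ U ∈ R, ∀ c : Iχ F θ.ν p (gOfRecord₁₃ F N θ p) 0,
      ∃ q ∈ plaqInside (cubeEnl (F.P p.K) (sideχ F θ.ν p (gOfRecord₁₃ F N θ p) 0) c 1),
        epsOfRecord θ.ν (gOfRecord₁₃ F N θ p) 1 * (F.P p.K).eta 1 ^ 2 + 4 * (2 * deltaOfRecord θ.ν (gOfRecord₁₃ F N θ p) 0 θ.A₁) ≤
          dist1 (plaqHol U q))
    (V1 : GaugeField (F.P p.K) 1 (SU N))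
    (h : ∀ c : Iχ F θ.ν p (gOfRecord₁₃ F N θ p) 0, chiFactor F N θ.ν p (gOfRecord₁₃ F N θ p) 0 c V1 = 1) :
    (avgDensity (avOfRecord F N p.K 0).avg V1 : ℝ) *
        ∫ U in R, rhoZeroOfRecord F N p.K p.g0 (EOfRecord₁₃ F N θ p) U ∂(avgKernel (avOfRecord F N p.K 0).avg V1) ≤
      slotsTOfRecord F N θ.ν θ.τ9 (EOfRecord₁₃ F N θ) (wOfRecord₉ F N θ.toStage9Params) θ.ppSel p (gOfRecord₁₃ F N θ p) 1 s V1 := by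
  rw [slotsTOfRecord_one_apply]
  have h0 : gOfRecord₁₃ F N θ p 0 = p.g0 := FlowStepRuns.genSeq_zero _ _
  rw [h0]
  show _ ≤ (avgDensity (avOfRecord F N p.K 0).avg V1 : ℝ) *
      ∫ U, wOfRecord₉ F N θ.toStage9Params p (gOfRecord₁₃ F N θ p) 0 s U V1 * rhoZeroOfRecord F N p.K p.g0 (EOfRecord₁₃ F N θ p) U
        ∂(avgKernel (avOfRecord F N p.K 0).avg V1)
  refine mul_le_mul_of_nonneg_left ?_ (avgDensity (avOfRecord F N p.K 0).avg V1).coe_nonneg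
  rw [← integral_indicator hRm]
  have hρm : Measurable (rhoZeroOfRecord F N p.K p.g0 (EOfRecord₁₃ F N θ p)) := measurable_rhoZeroOfRecord F N p.K _ _
  have hwm : Measurable (fun U : GaugeField (F.P p.K) 0 (SU N) => wOfRecord₉ F N θ.toStage9Params p (gOfRecord₁₃ F N θ p) 0 s U V1) :=
    measurable_wOfRecord_section_of_Omega_empty F N θ.ν θ.τ9.M θ.A₁ p (gOfRecord₁₃ F N θ p) 0 hζ s hΩ V1
  have hw0 : ∀ U, 0 ≤ wOfRecord₉ F N θ.toStage9Params p (gOfRecord₁₃ F N θ p) 0 s U V1 := fun U =>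
    wOfRecord_nonneg_of_Omega_empty F N θ.ν θ.τ9.M θ.A₁ p _ 0 hζ s hΩ U V1
  have hw1 : ∀ U, wOfRecord₉ F N θ.toStage9Params p (gOfRecord₁₃ F N θ p) 0 s U V1 ≤ 1 := fun U =>
    wOfRecord_le_one_of_Omega_empty F N θ.ν θ.τ9.M θ.A₁ p _ 0 hζ s hΩ U V1
  have hI : Integrable (fun U => wOfRecord₉ F N θ.toStage9Params p (gOfRecord₁₃ F N θ p) 0 s U V1 *
      rhoZeroOfRecord F N p.K p.g0 (EOfRecord₁₃ F N θ p) U) (avgKernel (avOfRecord F N p.K 0).avg V1) := by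
    refine (integrable_const (Real.exp (-EOfRecord₁₃ F N θ p))).mono' (hwm.mul hρm).aestronglyMeasurable
      (Filter.Eventually.of_forall fun U => ?_)
    rw [Real.norm_eq_abs, abs_mul, abs_of_pos (rhoZeroOfRecord_pos F N p.K _ _ U), abs_of_nonneg (hw0 U)]
    calc wOfRecord₉ F N θ.toStage9Params p (gOfRecord₁₃ F N θ p) 0 s U V1 * rhoZeroOfRecord F N p.K p.g0 (EOfRecord₁₃ F N θ p) U
        ≤ 1 * rhoZeroOfRecord F N p.K p.g0 (EOfRecord₁₃ F N θ p) U :=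
          mul_le_mul_of_nonneg_right (hw1 U) (rhoZeroOfRecord_pos F N p.K _ _ U).le
      _ ≤ Real.exp (-EOfRecord₁₃ F N θ p) := by rw [one_mul]; exact rhoZeroOfRecord_le F N p.K _ _ U
  refine integral_mono_of_nonneg (Filter.Eventually.of_forall fun U => ?_) hI (Filter.Eventually.of_forall fun U => ?_)
  · exact Set.indicator_nonneg (fun U _ => (rhoZeroOfRecord_pos F N p.K _ _ U).le) U
  · show R.indicator (rhoZeroOfRecord F N p.K p.g0 (EOfRecord₁₃ F N θ p)) U ≤
      wOfRecord₉ F N θ.toStage9Params p (gOfRecord₁₃ F N θ p) 0 s U V1 * rhoZeroOfRecord F N p.K p.g0 (EOfRecord₁₃ F N θ p) U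
    by_cases hU : U ∈ R
    · have hw : wOfRecord₉ F N θ.toStage9Params p (gOfRecord₁₃ F N θ p) 0 s U V1 = 1 :=
        wOfRecord_zero_eq_one_of_forall_chiFactor_eq_one_of_cubeRough F N θ.ν θ.τ9.M θ.A₁ p (gOfRecord₁₃ F N θ p) hζ hD hχ s hΩ U V1 h (hR U hU)
      rw [Set.indicator_of_mem hU, hw, one_mul]
    · rw [Set.indicator_of_notMem hU]
      exact mul_nonneg (hw0 U) (rhoZeroOfRecord_pos F N p.K _ _ U).le

/-- The fibre integral of `ρ₀ > 0` over a measurable `R` vanishes iff the averaging kernel gives `R` no mass. [cite: Balaban1985Averaging, (10) p.19 (bookkeeping)] -/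
theorem setIntegral_rhoZero_avgKernel_eq_zero_iff (K : ℕ) (g₀ E : ℝ) (V1 : GaugeField (F.P K) 1 (SU N))
    {R : Set (GaugeField (F.P K) 0 (SU N))} (hRm : MeasurableSet R) :
    ∫ U in R, rhoZeroOfRecord F N K g₀ E U ∂(avgKernel (avOfRecord F N K 0).avg V1) = 0 ↔ avgKernel (avOfRecord F N K 0).avg V1 R = 0 := by
  have hI : IntegrableOn (rhoZeroOfRecord F N K g₀ E) R (avgKernel (avOfRecord F N K 0).avg V1) :=
    ((integrable_const (Real.exp (-E))).mono' (measurable_rhoZeroOfRecord F N K g₀ E).aestronglyMeasurable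
      (Filter.Eventually.of_forall fun U => by
        rw [Real.norm_eq_abs, abs_of_pos (rhoZeroOfRecord_pos F N K g₀ E U)]
        exact rhoZeroOfRecord_le F N K g₀ E U)).integrableOn
  have hpos := setIntegral_pos_iff_support_of_nonneg_ae (μ := avgKernel (avOfRecord F N K 0).avg V1)
    (Filter.Eventually.of_forall fun U => (rhoZeroOfRecord_pos F N K g₀ E U).le) hI
  have hsupp : Function.support (rhoZeroOfRecord F N K g₀ E) = Set.univ :=
    Set.eq_univ_of_forall fun U => (rhoZeroOfRecord_pos F N K g₀ E U).ne'
  rw [hsupp, Set.univ_inter] at hpos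
  have hnn : 0 ≤ ∫ U in R, rhoZeroOfRecord F N K g₀ E U ∂(avgKernel (avOfRecord F N K 0).avg V1) :=
    setIntegral_nonneg hRm fun U _ => (rhoZeroOfRecord_pos F N K g₀ E U).le
  constructor
  · intro h; by_contra hne
    have h' : 0 < avgKernel (avOfRecord F N K 0).avg V1 R := pos_iff_ne_zero.2 hne
    rw [← hpos, h] at h'; exact lt_irrefl _ h'
  · intro h; by_contra hne
    have h' := lt_of_le_of_ne hnn (Ne.symm hne)
    rw [hpos, h] at h'; exact lt_irrefl _ h'

/-- **IF THE ALL-LARGE-FIELD SLOT VANISHES a.e. ON A CLASS `Ro` OF COARSE FIELDS, THEN ON ITS ALL-(3.2)-SMALL MEMBERS `avgDensity = 0 ∨ avgKernel(·)(R) = 0` a.e.**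
for any measurable set `R` of cube-rough old fields (under `TLaw₁₃ θ p 0`, `Ro` = the rough coarse fields by `…RoughFibre.slotsT_one_ae_zero_on_rough_of_tLaw₁₃` ∕
`…_of_Zt_eq_ZtOfRecord` ∕ `…_theta13LiveOfRecord` — one composition each; §4 spells out the last). [cite: Balaban1988Convergent, (3.1)–(3.5) pp.264–265, (3.25) p.270; Balaban1985Averaging, (10) p.19] -/
theorem avgDensity_zero_or_avgKernel_zero_ae_on_allSmall_of_slotsT_ae_zero (hζ : IsZetaUnity F N θ.ν θ.τ9.M θ.ζ)
    (hD : 0 < sideD F θ.ν θ.τ9.M p (gOfRecord₁₃ F N θ p) 0) (hχ : 0 < sideχ F θ.ν p (gOfRecord₁₃ F N θ p) 0)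
    (s : SeqOfRecord F θ.ν θ.τ9.M (gOfRecord₁₃ F N θ p) p.K 1) (hΩ : s.Ω 1 = ∅)
    {R : Set (GaugeField (F.P p.K) 0 (SU N))} (hRm : MeasurableSet R)
    (hR : ∀ U ∈ R, ∀ c : Iχ F θ.ν p (gOfRecord₁₃ F N θ p) 0,
      ∃ q ∈ plaqInside (cubeEnl (F.P p.K) (sideχ F θ.ν p (gOfRecord₁₃ F N θ p) 0) c 1),
        epsOfRecord θ.ν (gOfRecord₁₃ F N θ p) 1 * (F.P p.K).eta 1 ^ 2 + 4 * (2 * deltaOfRecord θ.ν (gOfRecord₁₃ F N θ p) 0 θ.A₁) ≤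
          dist1 (plaqHol U q))
    {Ro : GaugeField (F.P p.K) 1 (SU N) → Prop}
    (hvan : ∀ᵐ V1 ∂fieldMeasure (F.P p.K) 1 (SU N), Ro V1 →
      slotsTOfRecord F N θ.ν θ.τ9 (EOfRecord₁₃ F N θ) (wOfRecord₉ F N θ.toStage9Params) θ.ppSel p (gOfRecord₁₃ F N θ p) 1 s V1 = 0) :
    ∀ᵐ V1 ∂fieldMeasure (F.P p.K) 1 (SU N), Ro V1 →
      (∀ c : Iχ F θ.ν p (gOfRecord₁₃ F N θ p) 0, chiFactor F N θ.ν p (gOfRecord₁₃ F N θ p) 0 c V1 = 1) →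
        (avgDensity (avOfRecord F N p.K 0).avg V1 : ℝ) = 0 ∨ avgKernel (avOfRecord F N p.K 0).avg V1 R = 0 := by
  filter_upwards [hvan] with V1 hV1 hrough hsmall
  have hle := fibre_mass_le_slotsT_one_of_forall_chiFactor_eq_one θ p hζ hD hχ s hΩ hRm hR V1 hsmall
  rw [hV1 hrough] at hle
  have hnn : 0 ≤ (avgDensity (avOfRecord F N p.K 0).avg V1 : ℝ) *
      ∫ U in R, rhoZeroOfRecord F N p.K p.g0 (EOfRecord₁₃ F N θ p) U ∂(avgKernel (avOfRecord F N p.K 0).avg V1) :=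
    mul_nonneg (avgDensity (avOfRecord F N p.K 0).avg V1).coe_nonneg
      (setIntegral_nonneg hRm fun U _ => (rhoZeroOfRecord_pos F N p.K _ _ U).le)
  rcases mul_eq_zero.1 (le_antisymm hle hnn) with hd | hi
  · exact Or.inl hd
  · exact Or.inr ((setIntegral_rhoZero_avgKernel_eq_zero_iff p.K _ _ V1 hRm).1 hi)

/-- **MEASURE FORM**: if `avgDensity = 0 ∨ avgKernel(·)(R) = 0` a.e. on the all-(3.2)-small members of `Ro`, then for EVERY measurable set `S` of such fields
`dU{U ∈ R, Ū ∈ S} = 0` (the disintegration `dU = (dV₁·avgDensity) ⊗ avgKernel` read on the rectangle `S × R` through the graph `U ↦ (Ū, U)`; `0 < K`).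
[cite: Balaban1985Averaging, (10) p.19 (bookkeeping); Balaban1988Convergent, (3.1) p.264] -/
theorem fieldMeasure_inter_preimage_eq_zero_of_ae (hK : 0 < p.K) {Ro A : GaugeField (F.P p.K) 1 (SU N) → Prop}
    {R : Set (GaugeField (F.P p.K) 0 (SU N))} (hRm : MeasurableSet R)
    (hae : ∀ᵐ V1 ∂fieldMeasure (F.P p.K) 1 (SU N), Ro V1 → A V1 →
      (avgDensity (avOfRecord F N p.K 0).avg V1 : ℝ) = 0 ∨ avgKernel (avOfRecord F N p.K 0).avg V1 R = 0)
    {S : Set (GaugeField (F.P p.K) 1 (SU N))} (hS : MeasurableSet S) (hSR : ∀ V1 ∈ S, Ro V1) (hSA : ∀ V1 ∈ S, A V1) :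
    fieldMeasure (F.P p.K) 0 (SU N) (R ∩ (avOfRecord F N p.K 0).avg ⁻¹' S) = 0 := by
  set avg := (avOfRecord F N p.K 0).avg with havg_def
  have havg : Measurable avg := avOfRecord_measurable F N p.K 0
  have hac := avOfRecord_haarAC F N p.K 0 hK
  have hpre : R ∩ avg ⁻¹' S = (fun U => (avg U, U)) ⁻¹' (S ×ˢ R) := by
    ext U; simp [Set.mem_prod, and_comm]
  have hgraph : fieldMeasure (F.P p.K) 0 (SU N) (R ∩ avg ⁻¹' S) = jointLaw (fieldMeasure (F.P p.K) 0 (SU N)) avg (S ×ˢ R) := by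
    rw [hpre, jointLaw, Measure.map_apply (measurable_graphMap havg) (hS.prod hRm)]
  rw [hgraph, ← disintegration_fieldMeasure havg hac, Measure.compProd_apply_prod hS hRm,
    setLIntegral_withDensity_eq_setLIntegral_mul _ measurable_margDensity.coe_nnreal_ennreal (Kernel.measurable_coe _ hRm) hS]
  have hzero : ∀ᵐ V1 ∂fieldMeasure (F.P p.K) 1 (SU N), V1 ∈ S →
      ((fun V => (avgDensity avg V : ℝ≥0∞)) * fun V => avgKernel avg V R) V1 = 0 := by
    filter_upwards [hae] with V1 hV1 hmem
    rcases hV1 (hSR V1 hmem) (hSA V1 hmem) with hd | hk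
    · have hd' : (avgDensity avg V1 : ℝ≥0∞) = 0 := ENNReal.coe_eq_zero.2 (NNReal.coe_eq_zero.1 hd)
      simp [hd']
    · simp [hk]
  rw [lintegral_congr_ae ((ae_restrict_iff' hS).2 (hzero.mono fun V1 h => h)), lintegral_zero]

end AllSmall

/-! ## §4. At K0a's witness of record `theta13LiveOfRecord` (`M = M₂ = 1`, ζ of record, `Zt = ZtOfRecord`): only `0 ≤ g₀`, `0 < K`, the guards, `TLaw₁₃` left -/

section AtRecord

/-- `R_k` of record is positive (`L^s` on the printed branch, `1` on the junk branch; `0 < L`). [cite: Balaban1988Convergent, (2.5) p.255 (bookkeeping)] -/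
theorem RkOfRecord_pos {L : ℕ} (hL : 0 < L) (r : ℕ) (g : ℝ) : 0 < RkOfRecord L r g := by
  unfold RkOfRecord
  split_ifs
  · exact pow_pos hL _
  · exact one_pos

/-- The side of the 𝐃_{k+1}-cubes of record is positive as soon as `0 < M` (`0 < L` always). [cite: Balaban1988Convergent, (2.1) p.254 (bookkeeping)] -/
theorem sideD_pos (ν : Stage7Numerics) {M : ℕ} (hM : 0 < M) (p : B12.RunParams) (g : ℕ → ℝ) (k : ℕ) : 0 < sideD F ν M p g k := by
  unfold sideD dCubeSide
  exact Nat.mul_pos (Nat.mul_pos (pow_pos (F.P p.K).L_pos _) hM) (RkOfRecord_pos (F.P p.K).L_pos _ _)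

/-- The side of the χ_{k+1}-cubes of record is positive as soon as `0 < M₂` (`0 < L` always). [cite: Balaban1988Convergent, (2.17) p.257, (3.2) p.265 (bookkeeping)] -/
theorem sideχ_pos {ν : Stage7Numerics} (hM₂ : 0 < ν.M₂) (p : B12.RunParams) (g : ℕ → ℝ) (k : ℕ) : 0 < sideχ F ν p g k := by
  unfold sideχ cubeSide
  exact Nat.mul_pos (Nat.mul_pos (pow_pos (F.P p.K).L_pos _) hM₂) (RkOfRecord_pos (F.P p.K).L_pos _ _)

variable (F N)

/-- **AT K0a's WITNESS OF RECORD, THE ROUGH ALL-(3.2)-LARGE COARSE FIELDS CARRY NO AVERAGED MASS** if K1‴'s N11 conjunct survives its first step there: on every run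
with `0 ≤ g₀`, `0 < K`, `TLaw₁₃ θ₁₃ p 0` ⇒ `avgDensity(V₁) = 0` for a.e. `V₁` not `2α₀`-plaquette-small with every χ₁-cube (3.2)-large (`ε₀(g₀) ≤ α₀η₁²`,
[B7] guards on `α₀`). [cite: Balaban1988Convergent, Theorem p.245, (3.25) p.270, (3.2) p.265, (2.12) p.256; Balaban1985Averaging, Prop. 2 (53) p.26] -/
theorem avgDensity_ae_zero_on_rough_allLarge_theta13LiveOfRecord (p : B12.RunParams) (hg : 0 ≤ p.g0) (hK : 0 < p.K)
    (s : SeqOfRecord F (theta13LiveOfRecord F N).ν (theta13LiveOfRecord F N).τ9.M (gOfRecord₁₃ F N (theta13LiveOfRecord F N) p) p.K 1)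
    (hΩ : s.Ω 1 = ∅) (hT : TLaw₁₃ F N (theta13LiveOfRecord F N) p 0) {α₀ : ℝ} (hα : 0 < α₀)
    (hα3 : (143 * (((((F.P p.K).d + 4 : ℕ) : ℝ)) ^ 2 / 4) ^ 2) * α₀ ≤ 1 / 3)
    (hα2 : 2 * α₀ ≤ 2 * deltaSU (Fin N) / ((((F.P p.K).d + 4) * (F.P p.K).L : ℕ) : ℝ) ^ 2)
    (hαε : (theta13LiveOfRecord F N).s2.cR * epsOfRecord (theta13LiveOfRecord F N).ν (gOfRecord₁₃ F N (theta13LiveOfRecord F N) p) 0 ≤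
      α₀ * (F.P p.K).eta 1 ^ 2) :
    ∀ᵐ V1 ∂fieldMeasure (F.P p.K) 1 (SU N), ¬ PlaqSmall (2 * α₀ * (((F.P p.K).L : ℝ) ^ 1 * (F.P p.K).eta 1) ^ 2) V1 →
      (∀ c : Iχ F (theta13LiveOfRecord F N).ν p (gOfRecord₁₃ F N (theta13LiveOfRecord F N) p) 0,
        chiFactor F N (theta13LiveOfRecord F N).ν p (gOfRecord₁₃ F N (theta13LiveOfRecord F N) p) 0 c V1 = 0) →
        (avgDensity (avOfRecord F N p.K 0).avg V1 : ℝ) = 0 :=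
  avgDensity_ae_zero_on_allLarge_of_slotsT_ae_zero _ p (hasResidualsOfRecord_theta13LiveOfRecord F N).zetaUnity
    (sideD_pos _ (one_le_M_theta13LiveOfFamily F N eps0OfRecord₁₃ _ _ (ZtOfRecord F N)) p _ 0) (sideχ_pos Nat.one_pos p _ 0) s hΩ
    (slotsT_one_ae_zero_on_rough_theta13LiveOfRecord F N p hg hK s hΩ hT hα hα3 hα2 hαε)

/-- **AT K0a's WITNESS OF RECORD, THE ROUGH ALL-(3.2)-SMALL COARSE FIELDS CARRY NO CUBE-ROUGH FINE FIELD ON THEIR FIBRES** if K1‴'s N11 conjunct survives its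
first step there: `TLaw₁₃ θ₁₃ p 0` ⇒ `avgDensity(V₁) = 0 ∨ avgKernel(V₁)(R) = 0` for a.e. `V₁` not `2α₀`-plaquette-small with every χ₁-cube (3.2)-small, for every
measurable set `R` of cube-rough old fields (`0 ≤ g₀`, `0 < K`, guards). [cite: Balaban1988Convergent, Theorem p.245, (3.25) p.270, (3.2)–(3.3) p.265, (2.12) p.256; Balaban1985Averaging, Prop. 2 (53) p.26] -/
theorem avgDensity_zero_or_avgKernel_cubeRough_zero_ae_theta13LiveOfRecord (p : B12.RunParams) (hg : 0 ≤ p.g0) (hK : 0 < p.K)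
    (s : SeqOfRecord F (theta13LiveOfRecord F N).ν (theta13LiveOfRecord F N).τ9.M (gOfRecord₁₃ F N (theta13LiveOfRecord F N) p) p.K 1)
    (hΩ : s.Ω 1 = ∅) (hT : TLaw₁₃ F N (theta13LiveOfRecord F N) p 0) {α₀ : ℝ} (hα : 0 < α₀)
    (hα3 : (143 * (((((F.P p.K).d + 4 : ℕ) : ℝ)) ^ 2 / 4) ^ 2) * α₀ ≤ 1 / 3)
    (hα2 : 2 * α₀ ≤ 2 * deltaSU (Fin N) / ((((F.P p.K).d + 4) * (F.P p.K).L : ℕ) : ℝ) ^ 2)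
    (hαε : (theta13LiveOfRecord F N).s2.cR * epsOfRecord (theta13LiveOfRecord F N).ν (gOfRecord₁₃ F N (theta13LiveOfRecord F N) p) 0 ≤
      α₀ * (F.P p.K).eta 1 ^ 2)
    {R : Set (GaugeField (F.P p.K) 0 (SU N))} (hRm : MeasurableSet R)
    (hR : ∀ U ∈ R, ∀ c : Iχ F (theta13LiveOfRecord F N).ν p (gOfRecord₁₃ F N (theta13LiveOfRecord F N) p) 0,
      ∃ q ∈ plaqInside (cubeEnl (F.P p.K) (sideχ F (theta13LiveOfRecord F N).ν p (gOfRecord₁₃ F N (theta13LiveOfRecord F N) p) 0) c 1),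
        epsOfRecord (theta13LiveOfRecord F N).ν (gOfRecord₁₃ F N (theta13LiveOfRecord F N) p) 1 * (F.P p.K).eta 1 ^ 2 +
            4 * (2 * deltaOfRecord (theta13LiveOfRecord F N).ν (gOfRecord₁₃ F N (theta13LiveOfRecord F N) p) 0 (theta13LiveOfRecord F N).A₁) ≤
          dist1 (plaqHol U q)) :
    ∀ᵐ V1 ∂fieldMeasure (F.P p.K) 1 (SU N), ¬ PlaqSmall (2 * α₀ * (((F.P p.K).L : ℝ) ^ 1 * (F.P p.K).eta 1) ^ 2) V1 →
      (∀ c : Iχ F (theta13LiveOfRecord F N).ν p (gOfRecord₁₃ F N (theta13LiveOfRecord F N) p) 0,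
        chiFactor F N (theta13LiveOfRecord F N).ν p (gOfRecord₁₃ F N (theta13LiveOfRecord F N) p) 0 c V1 = 1) →
        (avgDensity (avOfRecord F N p.K 0).avg V1 : ℝ) = 0 ∨ avgKernel (avOfRecord F N p.K 0).avg V1 R = 0 :=
  avgDensity_zero_or_avgKernel_zero_ae_on_allSmall_of_slotsT_ae_zero _ p (hasResidualsOfRecord_theta13LiveOfRecord F N).zetaUnity
    (sideD_pos _ (one_le_M_theta13LiveOfFamily F N eps0OfRecord₁₃ _ _ (ZtOfRecord F N)) p _ 0) (sideχ_pos Nat.one_pos p _ 0) s hΩ hRm hR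
    (slotsT_one_ae_zero_on_rough_theta13LiveOfRecord F N p hg hK s hΩ hT hα hα3 hα2 hαε)

end AtRecord

end Summit.QuantumFields.YangMills.Theorems.BalabanUVNodesN11AllLargeFieldLabel

end
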